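import Mathlib
import HarnessLib
import Summits.NavierStokesRegularity.NavierStokesRegularity.Theorems.TaylorModelRungThreeReadoutFlowVar
import Summits.NavierStokesRegularity.NavierStokesRegularity.Theorems.TaylorModelRungThreeSoundnessVectorAlong
import Summits.NavierStokesRegularity.NavierStokesRegularity.Theorems.TaylorModelRungThreeSoundnessVectorScale

/-!
# Line `taylor-model` on crux K1b-DR (stmt-NavierStokesRegularity-23954) — (E) flow-side consumer of the vector
# step, part 1: the SELECTOR FLOW in cascade coordinates and its (F0) (F1′) (F2) (F5′-centre) clauses from the
# rough-enclosure test

The v3 flow witness is `φ j := liftFlow cd (flowSel (Qw cd))` — the global selector of the window system (S1's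
`flowSel`, engine-1's window dictionary `toVec/ofVec/Qw/liftFlow`), NOT a majorant power series: every clause of
the v3 flow package (`IsFlowPackageV`, draft `Cruxes/DerivativeEnclosureCertificateR/Lines/taylor_model_v3_VDefs.lean`)
is obtained from the landed VECTOR-LEMMAS files.  This part, with the certificate clauses passed as EXPLICIT
hypotheses in cascade coordinates (so it does not depend on the final text of `ChainV`):

* `majorantQw` — stage data (`ω j > 0`, `0 ≤ bb j`, the bilinear bound (B)) give
  `IsMajorantSystem (nW cd) (Qw cd) (wW cd j) (cd.bb j) (taylorJet (Qw cd)) (varJet (Qw cd))` (only bilinearity and the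
  jet recursions are used downstream — no `b·m·t < 1` anywhere);
* `toVec_taylorJet`, `toVec_varJet` — cascade jets read in window coordinates are the window jets;
* `ofVec_window_bounds`, `toVec_mem_Icc_of_bounds` — the box dictionary;
* (F0) `liftFlowSel_off_window`, `liftFlowSel_zero`, (F2) `liftFlowSel_unique` (every solution of K1b-DR's ODE clause
  IS the selector flow — unconditional);
* (F1′)+(F5′) `solvesOn_liftFlowSel_of_test`, `window_bounds_liftFlowSel_of_test`, `taylor_liftFlowSel_of_test` — from
  the first-order test at the start point `x` and the jet enclosure of order `p+1` over the state box: the selector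
  flow solves on `[0,h]`, stays in the box, and `|φ(x,u) − Σ_{n≤p} taylorJet cd.Qb x n · u^n|_{ik} ≤ J i k · u^(p+1)`.

MODEL-lattice rung TL-M3 only; nothing here is a statement about the Navier–Stokes equations.
-/

noncomputable section

-- the sub-problem namespace repeats the summit name by design (D-0017)
set_option linter.dupNamespace false

namespace Summit.NavierStokesRegularity.NavierStokesRegularity.Theorems.TaylorModelReadout

open Set Finset
open Literature.Analysis.FluidPDE.TaoCascade Literature.Analysis.FluidPDE.TaoCascade.TaylorChain
open Summit.NavierStokesRegularity.NavierStokesRegularity.Theorems.TaylorModelMajorant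
open Summit.NavierStokesRegularity.NavierStokesRegularity.Theorems.TaylorModelVector

variable {cd : CertData}

/-! ### The window system is an `IsMajorantSystem` (bilinearity + recursions; stage weights) -/

/-- Stage data give S1's packaged hypotheses for the window system. [folklore] -/
theorem majorantQw {j : ℕ} (hω : ∀ k, 0 < cd.ω j k) (hbb : 0 ≤ cd.bb j)
    (hB : ∀ (u v : Fin 4 → ℤ → ℝ) (Nu Nv : ℝ), 0 ≤ Nu → 0 ≤ Nv →
      cd.InBall j u Nu → cd.InBall j v Nv → cd.InBall j (cd.Qb u v) (cd.bb j * Nu * Nv)) :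
    IsMajorantSystem (nW cd) (Qw cd) (wW cd j) (cd.bb j) (taylorJet (Qw cd)) (varJet (Qw cd)) :=
  { w_pos := wW_pos cd hω
    b_nonneg := hbb
    linear_right := isLinearMap_Qw_right cd
    linear_left := isLinearMap_Qw_left cd
    bound := Qw_weighted_bound cd hB
    T_zero := taylorJet_zero (Qw cd)
    T_succ := taylorJet_succ_apply (Qw cd)
    U_zero := varJet_zero (Qw cd)
    U_succ := varJet_succ_apply (Qw cd) }

/-! ### Jets and boxes through the window dictionary -/

/-- `toVec` of a finite sum. [folklore] -/
theorem toVec_sum {α : Type*} (s : Finset α) (f : α → Fin 4 → ℤ → ℝ) :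
    toVec cd (∑ a ∈ s, f a) = ∑ a ∈ s, toVec cd (f a) := by
  funext c
  simp [toVec, Finset.sum_apply]

/-- Cascade-coordinate Taylor jets, read in window coordinates, are the window jets. [folklore] -/
theorem toVec_taylorJet (y : Fin 4 → ℤ → ℝ) : ∀ n, toVec cd (taylorJet cd.Qb y n) = taylorJet (Qw cd) (toVec cd y) n := by
  intro n
  refine eq_taylorJet_of_rec (Qw cd) (toVec cd y) (P := fun n => toVec cd (taylorJet cd.Qb y n)) (p := n)
    (by simp) (fun m _ => ?_) n le_rfl
  have h := congrArg (toVec cd) (taylorJet_succ cd.Qb y m)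
  rw [toVec_smul] at h
  rw [h, toVec_sum]
  simp only [Qw_toVec]

/-- Cascade-coordinate variational jets, read in window coordinates, are the window variational jets. [folklore] -/
theorem toVec_varJet (y v : Fin 4 → ℤ → ℝ) :
    ∀ n, toVec cd (varJet cd.Qb y v n) = varJet (Qw cd) (toVec cd y) (toVec cd v) n := by
  intro n
  refine eq_varJet_of_rec (Qw cd) (toVec cd y) (toVec cd v) (W := fun n => toVec cd (varJet cd.Qb y v n)) (p := n)
    (by simp) (fun m _ => ?_) n le_rfl
  have h := congrArg (toVec cd) (varJet_succ cd.Qb y v m)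
  rw [toVec_smul] at h
  rw [h, toVec_sum]
  simp only [toVec_add, ← toVec_taylorJet, Qw_toVec]

/-- Window bounds of a zero extension are the bounds of the vector. [folklore] -/
theorem ofVec_window_bounds {lo hi : Fin 4 → ℤ → ℝ} {yv : Fin (nW cd) → ℝ}
    (h : yv ∈ Icc (toVec cd lo) (toVec cd hi)) :
    ∀ i k, -cd.Kb ≤ k → k ≤ cd.Ka → lo i k ≤ ofVec cd yv i k ∧ ofVec cd yv i k ≤ hi i k := by
  intro i k hk1 hk2
  have hk : -cd.Kb ≤ k ∧ k ≤ cd.Ka := ⟨hk1, hk2⟩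
  rw [ofVec_apply_of_mem cd yv i hk]
  have h1 := h.1 (eW cd (i, ⟨k, Finset.mem_Icc.2 hk⟩))
  have h2 := h.2 (eW cd (i, ⟨k, Finset.mem_Icc.2 hk⟩))
  simp only [toVec, modeOf, shellOf, Equiv.symm_apply_apply] at h1 h2
  exact ⟨h1, h2⟩

/-- Window bounds of a state give box membership of its window vector. [folklore] -/
theorem toVec_mem_Icc_of_bounds {lo hi y : Fin 4 → ℤ → ℝ}
    (h : ∀ i k, -cd.Kb ≤ k → k ≤ cd.Ka → lo i k ≤ y i k ∧ y i k ≤ hi i k) :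
    toVec cd y ∈ Icc (toVec cd lo) (toVec cd hi) :=
  ⟨fun c => (h _ _ (shellOf_mem cd c).1 (shellOf_mem cd c).2).1,
   fun c => (h _ _ (shellOf_mem cd c).1 (shellOf_mem cd c).2).2⟩

/-- Box membership of the window vector gives the window bounds. [folklore] -/
theorem bounds_of_toVec_mem_Icc {lo hi y : Fin 4 → ℤ → ℝ} (h : toVec cd y ∈ Icc (toVec cd lo) (toVec cd hi)) :
    ∀ i k, -cd.Kb ≤ k → k ≤ cd.Ka → lo i k ≤ y i k ∧ y i k ≤ hi i k := by
  intro i k hk1 hk2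
  have h1 := ofVec_window_bounds (cd := cd) h i k hk1 hk2
  rwa [ofVec_toVec, trunc_apply, if_pos ⟨hk1, hk2⟩] at h1

/-! ### The selector flow: (F0), initial value, (F2) -/

/-- **(F0)** Off-window components of the selector flow vanish. [folklore] -/
theorem liftFlowSel_off_window (z : Fin 4 → ℤ → ℝ) (i : Fin 4) {k : ℤ} (h : ¬(-cd.Kb ≤ k ∧ k ≤ cd.Ka)) (t : ℝ) :
    liftFlow cd (fun x s => flowSel (Qw cd) x s) z i k t = 0 :=
  liftFlow_off_window z i h t

/-- The selector flow starts at (the window part of) its datum. [folklore] -/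
theorem liftFlowSel_zero (z : Fin 4 → ℤ → ℝ) (i : Fin 4) {k : ℤ} (hk : -cd.Kb ≤ k ∧ k ≤ cd.Ka) :
    liftFlow cd (fun x s => flowSel (Qw cd) x s) z i k 0 = z i k := by
  rw [liftFlow_of_mem z i hk, flowSel_zero]
  simp [toVec, modeOf, shellOf]

/-- A solution of K1b-DR's ODE clause on `[0,T]` from `z`, read in window coordinates, solves the window system.
[folklore] -/
theorem isSolOn_toVec_of_solves {z : Fin 4 → ℤ → ℝ} {T : ℝ} {ψ : Fin 4 → ℤ → ℝ → ℝ}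
    (hψ : ∀ i k, -cd.Kb ≤ k → k ≤ cd.Ka → ψ i k 0 = z i k ∧ ∀ t' ∈ Icc 0 T,
      HasDerivWithinAt (ψ i k)
        (quadTerm 1 cd.α (fun j' n s' => if -cd.Kb ≤ n ∧ n ≤ cd.Ka then ψ j' n s' else 0) i k t')
        (Icc 0 T) t') :
    IsSolOn (Qw cd) (toVec cd z) T (fun s => toVec cd (fun i k => ψ i k s)) := by
  refine ⟨?_, fun s hs => ?_⟩
  · funext c
    simp only [toVec]
    exact (hψ _ _ (shellOf_mem cd c).1 (shellOf_mem cd c).2).1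
  · refine hasDerivWithinAt_pi.2 fun c => ?_
    have hk := shellOf_mem cd c
    have h1 := (hψ (modeOf cd c) (shellOf cd c) hk.1 hk.2).2 s hs
    rw [quadTerm_trunc_eq_qT (cd := cd) _ _ hk, qT_eq_Qw_apply (cd := cd) _ _ hk] at h1
    have hc : eW cd (modeOf cd c, ⟨shellOf cd c, Finset.mem_Icc.2 hk⟩) = c := Equiv.apply_symm_apply (eW cd) c
    rw [hc] at h1
    exact h1

/-- **(F2)** Every solution of K1b-DR's ODE clause on `[0, T]` from `z` coincides (window components) with the
selector flow — unconditional (uniqueness for the quadratic window system). [folklore] -/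
theorem liftFlowSel_unique {j : ℕ}
    (hMS : IsMajorantSystem (nW cd) (Qw cd) (wW cd j) (cd.bb j) (taylorJet (Qw cd)) (varJet (Qw cd)))
    {z : Fin 4 → ℤ → ℝ} {T : ℝ} {ψ : Fin 4 → ℤ → ℝ → ℝ}
    (hψ : ∀ i k, -cd.Kb ≤ k → k ≤ cd.Ka → ψ i k 0 = z i k ∧ ∀ t' ∈ Icc 0 T,
      HasDerivWithinAt (ψ i k)
        (quadTerm 1 cd.α (fun j' n s' => if -cd.Kb ≤ n ∧ n ≤ cd.Ka then ψ j' n s' else 0) i k t')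
        (Icc 0 T) t') :
    ∀ i k, -cd.Kb ≤ k → k ≤ cd.Ka → ∀ t' ∈ Icc 0 T,
      ψ i k t' = liftFlow cd (fun x s => flowSel (Qw cd) x s) z i k t' := by
  have hsol := isSolOn_toVec_of_solves (cd := cd) hψ
  intro i k hk1 hk2 t' ht'
  have hk : -cd.Kb ≤ k ∧ k ≤ cd.Ka := ⟨hk1, hk2⟩
  have h := congrFun (hMS.flowSel_eq hsol ht') (eW cd (i, ⟨k, Finset.mem_Icc.2 hk⟩))
  rw [liftFlow_of_mem z i hk, h]
  simp [toVec, modeOf, shellOf]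

/-! ### (F1′) and (F5′-centre) from the first-order test at a start point -/

section Test

variable {j : ℕ} {lo hi x : Fin 4 → ℤ → ℝ} {h : ℝ}

/-- The first-order test, transported to window coordinates. [folklore] -/
theorem roughEnclosure_toVec
    (henc : ∀ y : Fin 4 → ℤ → ℝ, (∀ i k, -cd.Kb ≤ k → k ≤ cd.Ka → lo i k ≤ y i k ∧ y i k ≤ hi i k) →
      ∀ u ∈ Icc (0:ℝ) h, ∀ i k, -cd.Kb ≤ k → k ≤ cd.Ka →
        lo i k ≤ (x + u • cd.Qb y y) i k ∧ (x + u • cd.Qb y y) i k ≤ hi i k) :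
    ∀ yv ∈ Icc (toVec cd lo) (toVec cd hi), ∀ u ∈ Icc (0:ℝ) h,
      toVec cd x + u • Qw cd yv yv ∈ Icc (toVec cd lo) (toVec cd hi) := by
  intro yv hyv u hu
  have h1 := henc (ofVec cd yv) (ofVec_window_bounds (cd := cd) hyv) u hu
  have h2 := toVec_mem_Icc_of_bounds (cd := cd) h1
  rw [toVec_add, toVec_smul] at h2
  simpa [Qw] using h2

/-- **(F1′a)** The selector flow from `x` solves K1b-DR's ODE clause on `[0,h]`. [folklore] -/
theorem solvesOn_liftFlowSel_of_test
    (hMS : IsMajorantSystem (nW cd) (Qw cd) (wW cd j) (cd.bb j) (taylorJet (Qw cd)) (varJet (Qw cd)))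
    (hh : 0 ≤ h) (hx : ∀ i k, -cd.Kb ≤ k → k ≤ cd.Ka → lo i k ≤ x i k ∧ x i k ≤ hi i k)
    (henc : ∀ y : Fin 4 → ℤ → ℝ, (∀ i k, -cd.Kb ≤ k → k ≤ cd.Ka → lo i k ≤ y i k ∧ y i k ≤ hi i k) →
      ∀ u ∈ Icc (0:ℝ) h, ∀ i k, -cd.Kb ≤ k → k ≤ cd.Ka →
        lo i k ≤ (x + u • cd.Qb y y) i k ∧ (x + u • cd.Qb y y) i k ≤ hi i k) :
    SolvesOn cd (fun _ => liftFlow cd (fun x s => flowSel (Qw cd) x s)) j x h := by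
  have hsol := (flowSel_isSolOn_mem_Icc hMS (toVec_mem_Icc_of_bounds (cd := cd) hx) hh
    (roughEnclosure_toVec henc)).1
  intro i k hk1 hk2
  have hk : -cd.Kb ≤ k ∧ k ≤ cd.Ka := ⟨hk1, hk2⟩
  refine ⟨liftFlowSel_zero x i hk, fun t' ht' => ?_⟩
  set c : Fin (nW cd) := eW cd (i, ⟨k, Finset.mem_Icc.2 hk⟩) with hc
  have hcomp : HasDerivWithinAt (fun s => flowSel (Qw cd) (toVec cd x) s c)
      (Qw cd (flowSel (Qw cd) (toVec cd x) t') (flowSel (Qw cd) (toVec cd x) t') c) (Icc 0 h) t' :=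
    (hasDerivWithinAt_pi.1 (hsol.2 t' ht')) c
  have hfun : (fun s => liftFlow cd (fun x s => flowSel (Qw cd) x s) x i k s) =
      fun s => flowSel (Qw cd) (toVec cd x) s c := by
    funext s; rw [liftFlow_of_mem x i hk]
  rw [show (fun _ => liftFlow cd (fun x s => flowSel (Qw cd) x s)) j x i k =
      fun s => liftFlow cd (fun x s => flowSel (Qw cd) x s) x i k s from rfl, hfun]
  convert hcomp using 1
  rw [quadTerm_trunc_eq_qT (cd := cd) _ i hk, qT_eq_Qw_apply (cd := cd) _ i hk]
  congr 1 <;>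
  · funext c'
    simp only [toVec]
    rw [liftFlow_of_mem _ _ (shellOf_mem cd c')]
    congr 1
    exact (Equiv.apply_symm_apply (eW cd) c')

/-- **(F1′b)** The selector flow from `x` stays in the state box on `[0,h]`. [folklore] -/
theorem window_bounds_liftFlowSel_of_test
    (hMS : IsMajorantSystem (nW cd) (Qw cd) (wW cd j) (cd.bb j) (taylorJet (Qw cd)) (varJet (Qw cd)))
    (hh : 0 ≤ h) (hx : ∀ i k, -cd.Kb ≤ k → k ≤ cd.Ka → lo i k ≤ x i k ∧ x i k ≤ hi i k)
    (henc : ∀ y : Fin 4 → ℤ → ℝ, (∀ i k, -cd.Kb ≤ k → k ≤ cd.Ka → lo i k ≤ y i k ∧ y i k ≤ hi i k) →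
      ∀ u ∈ Icc (0:ℝ) h, ∀ i k, -cd.Kb ≤ k → k ≤ cd.Ka →
        lo i k ≤ (x + u • cd.Qb y y) i k ∧ (x + u • cd.Qb y y) i k ≤ hi i k) :
    ∀ u ∈ Icc 0 h, ∀ i k, -cd.Kb ≤ k → k ≤ cd.Ka →
      lo i k ≤ stAt (fun _ => liftFlow cd (fun x s => flowSel (Qw cd) x s)) j x u i k ∧
        stAt (fun _ => liftFlow cd (fun x s => flowSel (Qw cd) x s)) j x u i k ≤ hi i k := by
  intro u hu
  have hbox := (flowSel_isSolOn_mem_Icc hMS (toVec_mem_Icc_of_bounds (cd := cd) hx) hh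
    (roughEnclosure_toVec henc)).2 u hu
  rw [stAt_liftFlow]
  exact ofVec_window_bounds (cd := cd) hbox

/-- **(F5′-centre)** With an order-`p+1` jet enclosure over the state box, the componentwise Taylor remainder of the
selector flow from `x` against the cascade jets at `x`. [folklore] -/
theorem taylor_liftFlowSel_of_test
    (hMS : IsMajorantSystem (nW cd) (Qw cd) (wW cd j) (cd.bb j) (taylorJet (Qw cd)) (varJet (Qw cd)))
    (hh : 0 ≤ h) (hx : ∀ i k, -cd.Kb ≤ k → k ≤ cd.Ka → lo i k ≤ x i k ∧ x i k ≤ hi i k)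
    (henc : ∀ y : Fin 4 → ℤ → ℝ, (∀ i k, -cd.Kb ≤ k → k ≤ cd.Ka → lo i k ≤ y i k ∧ y i k ≤ hi i k) →
      ∀ u ∈ Icc (0:ℝ) h, ∀ i k, -cd.Kb ≤ k → k ≤ cd.Ka →
        lo i k ≤ (x + u • cd.Qb y y) i k ∧ (x + u • cd.Qb y y) i k ≤ hi i k) {p : ℕ} {J : Fin 4 → ℤ → ℝ}
    (hJ : ∀ y : Fin 4 → ℤ → ℝ, (∀ i k, -cd.Kb ≤ k → k ≤ cd.Ka → lo i k ≤ y i k ∧ y i k ≤ hi i k) →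
      ∀ i k, -cd.Kb ≤ k → k ≤ cd.Ka → |taylorJet cd.Qb y (p + 1) i k| ≤ J i k) :
    ∀ u ∈ Icc 0 h, ∀ i k, -cd.Kb ≤ k → k ≤ cd.Ka →
      |stAt (fun _ => liftFlow cd (fun x s => flowSel (Qw cd) x s)) j x u i k
        - ∑ n ∈ Finset.range (p + 1), taylorJet cd.Qb x n i k * u ^ n| ≤ J i k * u ^ (p + 1) := by
  intro u hu i k hk1 hk2
  have hk : -cd.Kb ≤ k ∧ k ≤ cd.Ka := ⟨hk1, hk2⟩
  set c : Fin (nW cd) := eW cd (i, ⟨k, Finset.mem_Icc.2 hk⟩) with hc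
  have hJ' : ∀ yv ∈ Icc (toVec cd lo) (toVec cd hi), ∀ c', |taylorJet (Qw cd) yv (p + 1) c'| ≤ toVec cd J c' := by
    intro yv hyv c'
    have h1 := hJ (ofVec cd yv) (ofVec_window_bounds (cd := cd) hyv) (modeOf cd c') (shellOf cd c')
      (shellOf_mem cd c').1 (shellOf_mem cd c').2
    have h2 := congrFun (toVec_taylorJet (cd := cd) (ofVec cd yv) (p + 1)) c'
    rw [toVec_ofVec] at h2
    simp only [toVec] at h2 ⊢
    rw [← h2]
    exact h1
  have key := abs_flowSel_sub_taylor_le hMS (toVec_mem_Icc_of_bounds (cd := cd) hx) hh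
    (roughEnclosure_toVec henc) hJ' u hu c
  rw [stAt_liftFlow, ofVec_apply_of_mem cd _ i hk]
  have e1 : ∀ n, taylorJet (Qw cd) (toVec cd x) n c = taylorJet cd.Qb x n i k := by
    intro n
    rw [← toVec_taylorJet]
    simp [toVec, hc, modeOf, shellOf]
  have e2 : toVec cd J c = J i k := by simp [toVec, hc, modeOf, shellOf]
  simp only [e1, e2] at key
  exact key

end Test

end Summit.NavierStokesRegularity.NavierStokesRegularity.Theorems.TaylorModelReadout

end
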